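import Summits.HodgeConjecture.CorCM.PairFlipCMFieldOrbitCriterion
import Summits.HodgeConjecture.CorCM.DoubleFlipCMFieldsHodge
import HarnessLib

/-!
# A DOUBLE-FLIP CM field against ANY CM field: the orbit criterion for `Hg(A₀ × A₁) = Hg(A₀) × Hg(A₁)` with the even
# sign kernel only — octic fields with Galois closure of degree `32, 64, 96, 192`

COR-CM (cell `pub-hodgecm2`, binder seat `b16` gen 53, count-neutral claim ORBIT-CRITERION, file F6 — CM fields and
abelian varieties; theorems only, no definition, no named fact, no `sorry`).  NEW as stated, hence under `Summits/`.
HONEST FRAMING: unconditional statements about pairs of CM types and products of CM abelian varieties; `HC_CM` is neither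
used nor asserted.

F1/F2 (`StabiliserOrbitKernel`, `StabiliserOrbitCriterion`) need of the base slot only that `U(Φ_{i₀})` be IRREDUCIBLE
(and, for the nondegeneracy form, `Φ_{i₀}` nondegenerate); F3 (`PairFlipCMFieldOrbitCriterion`) supplied this from PAIR
FLIPS (full sign group `(ℤ₂)ⁿ ≤ Gal(K₀ᶜ/ℚ)`).  Gen 46's `DoubleFlipCMFieldsHodge` supplies both from DOUBLE FLIPS — for all
embeddings `s, t` in different conjugate pairs some `σ ∈ Aut(ℂ)` conjugates exactly the pairs of `s` and `t` — i.e. from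
the EVEN sign kernel `(ℤ₂)ⁿ⁻¹_{even} ≤ Gal(K₀ᶜ/ℚ)` when `[K₀ : ℚ] ≥ 6` (`irreducible_and_isNondegenerate_of_doubleFlip`;
Dodson's `v = n − 1`: octic fields with Galois closure of degree `32, 64, 96, 192`, which have NO pair flips).  This file
records the orbit criterion for such base fields, verbatim:

* §1 `k` ORBITS: **`cmFamilyRank_add_card_eq_iff_not_exists_orbitCoeff_of_doubleFlip`**,
  **`isNondegenerateFamily_iff_not_exists_orbitCoeff_of_doubleFlip`** — `K_{i₀}` double-flip of degree `≥ 6`, `K_{i₁}` ANY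
  CM field, orbit data `(O_j)` at `x₀` (each `O_j` homogeneous under `Aut(ℂ / x₀K_{i₀})`, separated, compositum test off
  `⋃ (O_j ∪ Ō_j)`): `Hg(A₀ × A₁) = Hg(A₀) × Hg(A₁)` IFF `u_{Φ₀}(g ∘ x₀)` is not a rational combination of the orbit
  shadows; nondegenerate IFF moreover `Φ₁` nondegenerate.
* §2 ONE ORBIT: **`cmFamilyRank_add_card_eq_iff_of_doubleFlip_of_orbit`**, **`isNondegenerateFamily_iff_of_doubleFlip_of_orbit`**
  — additive IFF the orbit multiplicities `#{y ∈ O : g ∘ y ∈ Φ₁}` are not constant-unequal according to `g ∘ x₀ ∈ Φ₀`.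
* §3 ABELIAN VARIETIES: **`hodgeConjectureFor_prod_of_doubleFlip_of_orbit`** (HC with `B• = D•` on every `A₀^a × A₁^b`
  under the one-orbit criterion, unconditionally), **`forall_prod_hodgeClassSpan_eq_iff_of_doubleFlip_of_orbit`** (simple
  non-isogenous realisations).  The degenerate direction needs no flips at all (F3
  `exists_exceptional_prod_of_orbitMultiplicities`).
For the `(4,4)` cell of the census: a CM fourfold whose octic field has even sign kernel but no pair flips, against ANY
CM fourfold, is decided by one orbit-multiplicity table whenever `Aut(ℂ / x₀K₀)` has a single conjugation-odd orbit pair on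
`Hom(K₁, ℂ)`.

## References

* [Dodson1984] B. Dodson, *The structure of Galois groups of CM-fields*, Trans. AMS 283 (1984), §1.1 (imprimitivity
  sequence, `v`), §5.1, §5.2 (`n = 4`).
* [Gordon1999HodgeAVSurvey] B. B. Gordon, *A survey of the Hodge conjecture for abelian varieties*, §3 Theorem (proof),
  7.5–7.7, 9.4.3, 10.10.
* [Serre1977] J.-P. Serre, *Linear Representations of Finite Groups*, GTM 42, §2.2, §7.2–7.4.
-/

noncomputable section

open CategoryTheory CategoryTheory.Limits NumberField Module
open scoped BigOperators

namespace Summit.HodgeConjecture.CorCM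

open Literature.NumberTheory.ComplexMultiplication
open Literature.AlgebraicGeometry.Motives (AbelianVariety CMType)
open Literature.AlgebraicGeometry.HodgeTheory
open Literature.AlgebraicGeometry.ComplexMultiplication (IsCMTypeRealisation)
open Literature.AlgebraicGeometry.VanGeemen1994 (hodgeClassSpan)
open Literature.AlgebraicGeometry.Pohlmann1968
open Literature.Barriers.HodgeConjecture (divisorClassesSpan)
open scoped Classical

variable {I : Type} {K : I → Type} [∀ i, Field (K i)] [∀ i, NumberField (K i)] [∀ i, IsCMField (K i)] [Fintype I]
  [DecidableEq I] {Φ : ∀ i, CMType (K i)} {i₀ i₁ : I}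

omit [∀ i, IsCMField (K i)] [DecidableEq I] in
/-- `|⊔_i Hom(K_i, ℂ)| = Σ_i [K_i : ℚ]`. [folklore] -/
private theorem card_sigma_ringHom_eq_sum₅₃d : Fintype.card ((i : I) × (K i →+* ℂ)) = ∑ i, finrank ℚ (K i) := by
  rw [Fintype.card_sigma]
  exact Finset.sum_congr rfl fun i _ => Embeddings.card (K i) ℂ

section Types

/-! ### §1 Any number of orbits -/

/-- **THE EXACT CRITERION, `k` ORBITS, DOUBLE-FLIP BASE (rank form).**  `I = {i₀, i₁}`, `K_{i₀}` of degree `≥ 6` with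
double flips, `K_{i₁}` ANY CM field, orbit data `(O_j)_j` at `x₀`: `rank(Φ₀, Φ₁) + 2 = rank Φ₀ + rank Φ₁ + 1`
(`Hg(A₀ × A₁) = Hg(A₀) × Hg(A₁)`) IFF there are NO constants `c_j ∈ ℚ` with
`u_{Φ₀}(g ∘ x₀) = Σ_j c_j Σ_{y∈O_j} u_{Φ₁}(g ∘ y)` for all `g ∈ Aut(ℂ)`.
[cite: Gordon1999HodgeAVSurvey, §3 Theorem (1) and 7.5–7.7] [cite: Dodson1984, §1.1 and §5.1] -/
theorem cmFamilyRank_add_card_eq_iff_not_exists_orbitCoeff_of_doubleFlip (hI : ∀ i, i = i₀ ∨ i = i₁) (h01 : i₀ ≠ i₁)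
    (h6 : 6 ≤ finrank ℚ (K i₀))
    (hflip : ∀ s t : K i₀ →+* ℂ, t ≠ s → t ≠ (starRingAut : ℂ ≃+* ℂ) • s → ∃ σ : ℂ ≃+* ℂ,
      σ • s = (starRingAut : ℂ ≃+* ℂ) • s ∧ σ • t = (starRingAut : ℂ ≃+* ℂ) • t ∧
      ∀ u : K i₀ →+* ℂ, u ≠ s → u ≠ (starRingAut : ℂ ≃+* ℂ) • s → u ≠ t → u ≠ (starRingAut : ℂ ≃+* ℂ) • t →
        σ • u = u)
    {x₀ : K i₀ →+* ℂ} {κ : Type} [Fintype κ] (O : κ → Set (K i₁ →+* ℂ))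
    (hO : ∀ j, ∀ y ∈ O j, ∀ y' ∈ O j, ∃ g : ℂ ≃+* ℂ, g • x₀ = x₀ ∧ g • y = y')
    (hdisj : ∀ j j', j ≠ j' → ∀ y ∈ O j, y ∉ O j' ∧ (starRingAut : ℂ ≃+* ℂ) • y ∉ O j')
    (hoff : ∀ y : K i₁ →+* ℂ, (∀ j, y ∉ O j ∧ (starRingAut : ℂ ≃+* ℂ) • y ∉ O j) →
      ∃ σ : ℂ ≃+* ℂ, σ • x₀ = (starRingAut : ℂ ≃+* ℂ) • x₀ ∧ σ • y = y) :
    CMAlgebra.cmFamilyRank Φ + Fintype.card I = (∑ i, cmTypeRank (Φ i)) + 1 ↔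
      ¬ ∃ c : κ → ℚ, ∀ g : ℂ ≃+* ℂ, antiVec (Φ i₀).1 (1 : ℂ ≃+* ℂ) (g • x₀) =
        ∑ j, c j * ∑ y ∈ Finset.univ.filter (fun y : K i₁ →+* ℂ => y ∈ O j),
          antiVec (Φ i₁).1 (1 : ℂ ≃+* ℂ) (g • y) := by
  haveI : Nonempty I := ⟨i₀⟩
  obtain ⟨hirr, -, -⟩ := irreducible_and_isNondegenerate_of_doubleFlip Φ h6 hflip
  exact Shadow.typeRank_sigmaType_add_card_eq_iff_not_exists_orbitCoeff (G := ℂ ≃+* ℂ) (Φ := fun i => (Φ i).1)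
    (fun i => isCMTypeWith_conj (Φ i)) hI h01 hirr O hO hdisj hoff

/-- **THE EXACT CRITERION, `k` ORBITS, DOUBLE-FLIP BASE (nondegeneracy form)**: the pair is nondegenerate IFF `Φ₁` is
nondegenerate and no orbit constants exist. [cite: Gordon1999HodgeAVSurvey, 7.5–7.7] [cite: Dodson1984, §1.1 and §5.1] -/
theorem isNondegenerateFamily_iff_not_exists_orbitCoeff_of_doubleFlip (hI : ∀ i, i = i₀ ∨ i = i₁) (h01 : i₀ ≠ i₁)
    (h6 : 6 ≤ finrank ℚ (K i₀))
    (hflip : ∀ s t : K i₀ →+* ℂ, t ≠ s → t ≠ (starRingAut : ℂ ≃+* ℂ) • s → ∃ σ : ℂ ≃+* ℂ,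
      σ • s = (starRingAut : ℂ ≃+* ℂ) • s ∧ σ • t = (starRingAut : ℂ ≃+* ℂ) • t ∧
      ∀ u : K i₀ →+* ℂ, u ≠ s → u ≠ (starRingAut : ℂ ≃+* ℂ) • s → u ≠ t → u ≠ (starRingAut : ℂ ≃+* ℂ) • t →
        σ • u = u)
    {x₀ : K i₀ →+* ℂ} {κ : Type} [Fintype κ] (O : κ → Set (K i₁ →+* ℂ))
    (hO : ∀ j, ∀ y ∈ O j, ∀ y' ∈ O j, ∃ g : ℂ ≃+* ℂ, g • x₀ = x₀ ∧ g • y = y')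
    (hdisj : ∀ j j', j ≠ j' → ∀ y ∈ O j, y ∉ O j' ∧ (starRingAut : ℂ ≃+* ℂ) • y ∉ O j')
    (hoff : ∀ y : K i₁ →+* ℂ, (∀ j, y ∉ O j ∧ (starRingAut : ℂ ≃+* ℂ) • y ∉ O j) →
      ∃ σ : ℂ ≃+* ℂ, σ • x₀ = (starRingAut : ℂ ≃+* ℂ) • x₀ ∧ σ • y = y) :
    CMAlgebra.IsNondegenerateFamily Φ ↔ IsNondegenerate (Φ i₁) ∧
      ¬ ∃ c : κ → ℚ, ∀ g : ℂ ≃+* ℂ, antiVec (Φ i₀).1 (1 : ℂ ≃+* ℂ) (g • x₀) =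
        ∑ j, c j * ∑ y ∈ Finset.univ.filter (fun y : K i₁ →+* ℂ => y ∈ O j),
          antiVec (Φ i₁).1 (1 : ℂ ≃+* ℂ) (g • y) := by
  haveI := isPretransitive_ringEquiv_complex (K := K i₀)
  haveI : Nonempty I := ⟨i₀⟩
  obtain ⟨hirr, -, -⟩ := irreducible_and_isNondegenerate_of_doubleFlip Φ h6 hflip
  have h6' : 6 ≤ Fintype.card (K i₀ →+* ℂ) := by rw [Embeddings.card]; exact h6
  have hnd₀ : typeRank (ℂ ≃+* ℂ) (Φ i₀).1 = Fintype.card (K i₀ →+* ℂ) / 2 + 1 :=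
    DoubleFlip.typeRank_eq_of_doubleFlip (isCMTypeWith_conj (Φ i₀)) h6' hflip
  have key := Shadow.typeRank_sigmaType_eq_iff_not_exists_orbitCoeff (G := ℂ ≃+* ℂ) (Φ := fun i => (Φ i).1)
    (fun i => isCMTypeWith_conj (Φ i)) hI h01 hirr hnd₀ O hO hdisj hoff
  rw [CMAlgebra.isNondegenerateFamily_iff, ← card_sigma_ringHom_eq_sum₅₃d (K := K), isNondegenerate_iff, cmTypeRank,
    ← Embeddings.card (K i₁) ℂ]
  exact key

/-! ### §2 One orbit -/

/-- **THE ONE-ORBIT CRITERION, DOUBLE-FLIP BASE (rank form).**  `K_{i₀}` of degree `≥ 6` with double flips, `K_{i₁}` ANY CM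
field, `O ⊆ Hom(K_{i₁}, ℂ)` homogeneous under `Aut(ℂ / x₀K_{i₀})`, compositum test off `O ∪ Ō`:
`rank(Φ₀, Φ₁) + 2 = rank Φ₀ + rank Φ₁ + 1` (`Hg(A₀ × A₁) = Hg(A₀) × Hg(A₁)`) IFF the orbit multiplicities
`#{y ∈ O : g ∘ y ∈ Φ₁}` are NOT constant-unequal according to `g ∘ x₀ ∈ Φ₀`.
[cite: Gordon1999HodgeAVSurvey, §3 Theorem (1), 7.5–7.7 and 9.4.3] [cite: Dodson1984, §1.1 and §5.1] -/
theorem cmFamilyRank_add_card_eq_iff_of_doubleFlip_of_orbit (hI : ∀ i, i = i₀ ∨ i = i₁) (h01 : i₀ ≠ i₁)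
    (h6 : 6 ≤ finrank ℚ (K i₀))
    (hflip : ∀ s t : K i₀ →+* ℂ, t ≠ s → t ≠ (starRingAut : ℂ ≃+* ℂ) • s → ∃ σ : ℂ ≃+* ℂ,
      σ • s = (starRingAut : ℂ ≃+* ℂ) • s ∧ σ • t = (starRingAut : ℂ ≃+* ℂ) • t ∧
      ∀ u : K i₀ →+* ℂ, u ≠ s → u ≠ (starRingAut : ℂ ≃+* ℂ) • s → u ≠ t → u ≠ (starRingAut : ℂ ≃+* ℂ) • t →
        σ • u = u)
    {x₀ : K i₀ →+* ℂ} (O : Set (K i₁ →+* ℂ)) (hO : ∀ y ∈ O, ∀ y' ∈ O, ∃ g : ℂ ≃+* ℂ, g • x₀ = x₀ ∧ g • y = y')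
    (hoff : ∀ y : K i₁ →+* ℂ, y ∉ O → (starRingAut : ℂ ≃+* ℂ) • y ∉ O →
      ∃ σ : ℂ ≃+* ℂ, σ • x₀ = (starRingAut : ℂ ≃+* ℂ) • x₀ ∧ σ • y = y) :
    CMAlgebra.cmFamilyRank Φ + Fintype.card I = (∑ i, cmTypeRank (Φ i)) + 1 ↔
      ¬ ∃ a b : ℕ, a ≠ b ∧ ∀ g : ℂ ≃+* ℂ,
        (Finset.univ.filter fun y : K i₁ →+* ℂ => y ∈ O ∧ g • y ∈ (Φ i₁).1).card =
          if g • x₀ ∈ (Φ i₀).1 then a else b := by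
  haveI : Nonempty I := ⟨i₀⟩
  obtain ⟨hirr, -, -⟩ := irreducible_and_isNondegenerate_of_doubleFlip Φ h6 hflip
  exact Shadow.typeRank_sigmaType_add_card_eq_iff_not_exists_orbitMultiplicities (G := ℂ ≃+* ℂ)
    (Φ := fun i => (Φ i).1) (fun i => isCMTypeWith_conj (Φ i)) hI h01 hirr O hO hoff

/-- **THE ONE-ORBIT CRITERION, DOUBLE-FLIP BASE (nondegeneracy form)**: the pair `(Φ₀, Φ₁)` is nondegenerate IFF `Φ₁` is
nondegenerate and its orbit multiplicities on `O` are not constant-unequal.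
[cite: Gordon1999HodgeAVSurvey, 7.5–7.7 and 9.4.3] [cite: Dodson1984, §1.1 and §5.1] -/
theorem isNondegenerateFamily_iff_of_doubleFlip_of_orbit (hI : ∀ i, i = i₀ ∨ i = i₁) (h01 : i₀ ≠ i₁)
    (h6 : 6 ≤ finrank ℚ (K i₀))
    (hflip : ∀ s t : K i₀ →+* ℂ, t ≠ s → t ≠ (starRingAut : ℂ ≃+* ℂ) • s → ∃ σ : ℂ ≃+* ℂ,
      σ • s = (starRingAut : ℂ ≃+* ℂ) • s ∧ σ • t = (starRingAut : ℂ ≃+* ℂ) • t ∧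
      ∀ u : K i₀ →+* ℂ, u ≠ s → u ≠ (starRingAut : ℂ ≃+* ℂ) • s → u ≠ t → u ≠ (starRingAut : ℂ ≃+* ℂ) • t →
        σ • u = u)
    {x₀ : K i₀ →+* ℂ} (O : Set (K i₁ →+* ℂ)) (hO : ∀ y ∈ O, ∀ y' ∈ O, ∃ g : ℂ ≃+* ℂ, g • x₀ = x₀ ∧ g • y = y')
    (hoff : ∀ y : K i₁ →+* ℂ, y ∉ O → (starRingAut : ℂ ≃+* ℂ) • y ∉ O →
      ∃ σ : ℂ ≃+* ℂ, σ • x₀ = (starRingAut : ℂ ≃+* ℂ) • x₀ ∧ σ • y = y) :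
    CMAlgebra.IsNondegenerateFamily Φ ↔ IsNondegenerate (Φ i₁) ∧
      ¬ ∃ a b : ℕ, a ≠ b ∧ ∀ g : ℂ ≃+* ℂ,
        (Finset.univ.filter fun y : K i₁ →+* ℂ => y ∈ O ∧ g • y ∈ (Φ i₁).1).card =
          if g • x₀ ∈ (Φ i₀).1 then a else b := by
  haveI := isPretransitive_ringEquiv_complex (K := K i₀)
  haveI : Nonempty I := ⟨i₀⟩
  obtain ⟨hirr, -, -⟩ := irreducible_and_isNondegenerate_of_doubleFlip Φ h6 hflip
  have h6' : 6 ≤ Fintype.card (K i₀ →+* ℂ) := by rw [Embeddings.card]; exact h6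
  have hnd₀ : typeRank (ℂ ≃+* ℂ) (Φ i₀).1 = Fintype.card (K i₀ →+* ℂ) / 2 + 1 :=
    DoubleFlip.typeRank_eq_of_doubleFlip (isCMTypeWith_conj (Φ i₀)) h6' hflip
  have key := Shadow.typeRank_sigmaType_eq_iff_not_exists_orbitMultiplicities (G := ℂ ≃+* ℂ)
    (Φ := fun i => (Φ i).1) (fun i => isCMTypeWith_conj (Φ i)) hI h01 hirr hnd₀ O hO hoff
  rw [CMAlgebra.isNondegenerateFamily_iff, ← card_sigma_ringHom_eq_sum₅₃d (K := K), isNondegenerate_iff, cmTypeRank,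
    ← Embeddings.card (K i₁) ℂ]
  exact key

end Types

/-! ### §3 Abelian varieties -/

section Varieties

variable [Nonempty I] {A : I → AbelianVariety ℂ} {ι : ∀ i, 𝓞 (K i) →+* End (A i)}
  {θ : ∀ i, K i →+* Module.End ℂ (complexBetti (A i).X 1)}

/-- **The Hodge conjecture on every `A₀^a × A₁^b`** (every `⨁_{j<N} A_{π j}`), with `B• = D•` there, for realisations of a
type of a double-flip CM field of degree `≥ 6` and a NONDEGENERATE type of ANY CM field whose orbit multiplicities on a
homogeneous `O` (compositum test off `O ∪ Ō`) are not constant-unequal — UNCONDITIONALLY.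
[cite: Gordon1999HodgeAVSurvey, 7.5 and 10.10] -/
theorem hodgeConjectureFor_prod_of_doubleFlip_of_orbit (hI : ∀ i, i = i₀ ∨ i = i₁) (h01 : i₀ ≠ i₁)
    (h6 : 6 ≤ finrank ℚ (K i₀))
    (hflip : ∀ s t : K i₀ →+* ℂ, t ≠ s → t ≠ (starRingAut : ℂ ≃+* ℂ) • s → ∃ σ : ℂ ≃+* ℂ,
      σ • s = (starRingAut : ℂ ≃+* ℂ) • s ∧ σ • t = (starRingAut : ℂ ≃+* ℂ) • t ∧
      ∀ u : K i₀ →+* ℂ, u ≠ s → u ≠ (starRingAut : ℂ ≃+* ℂ) • s → u ≠ t → u ≠ (starRingAut : ℂ ≃+* ℂ) • t →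
        σ • u = u)
    {x₀ : K i₀ →+* ℂ} (O : Set (K i₁ →+* ℂ)) (hO : ∀ y ∈ O, ∀ y' ∈ O, ∃ g : ℂ ≃+* ℂ, g • x₀ = x₀ ∧ g • y = y')
    (hoff : ∀ y : K i₁ →+* ℂ, y ∉ O → (starRingAut : ℂ ≃+* ℂ) • y ∉ O →
      ∃ σ : ℂ ≃+* ℂ, σ • x₀ = (starRingAut : ℂ ≃+* ℂ) • x₀ ∧ σ • y = y)
    (hnd : IsNondegenerate (Φ i₁))
    (hnot : ¬ ∃ a b : ℕ, a ≠ b ∧ ∀ g : ℂ ≃+* ℂ,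
      (Finset.univ.filter fun y : K i₁ →+* ℂ => y ∈ O ∧ g • y ∈ (Φ i₁).1).card = if g • x₀ ∈ (Φ i₀).1 then a else b)
    (hA : ∀ i, IsCMTypeRealisation (Φ i) (A i) (ι i) (θ i)) {N : ℕ} (π : Fin N → I) :
    HodgeConjectureFor (⨁ fun j : Fin N => A (π j)).dim (⨁ fun j : Fin N => A (π j)).X ∧
      ∀ m : ℕ, hodgeClassSpan (⨁ fun j : Fin N => A (π j)).dim (⨁ fun j : Fin N => A (π j)).X m =
        divisorClassesSpan (⨁ fun j : Fin N => A (π j)).X (⨁ fun j : Fin N => A (π j)).dim m :=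
  have h := (isNondegenerateFamily_iff_of_doubleFlip_of_orbit hI h01 h6 hflip O hO hoff).2 ⟨hnd, hnot⟩
  ⟨h.hodgeConjectureFor_prod hA π, fun m => h.hodgeClassSpan_prod_eq_divisorClassesSpan hA π m⟩

/-- **SIMPLE, NON-ISOGENOUS realisations, double-flip base, one orbit: `B• = D•` on ALL products `A₀^a × A₁^b` IFF `Φ₁`
is nondegenerate and its orbit multiplicities are not constant-unequal**; otherwise some product carries an exceptional
Hodge class. [cite: Gordon1999HodgeAVSurvey, 7.5 and 7.6.1] -/
theorem forall_prod_hodgeClassSpan_eq_iff_of_doubleFlip_of_orbit (hI : ∀ i, i = i₀ ∨ i = i₁) (h01 : i₀ ≠ i₁)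
    (h6 : 6 ≤ finrank ℚ (K i₀))
    (hflip : ∀ s t : K i₀ →+* ℂ, t ≠ s → t ≠ (starRingAut : ℂ ≃+* ℂ) • s → ∃ σ : ℂ ≃+* ℂ,
      σ • s = (starRingAut : ℂ ≃+* ℂ) • s ∧ σ • t = (starRingAut : ℂ ≃+* ℂ) • t ∧
      ∀ u : K i₀ →+* ℂ, u ≠ s → u ≠ (starRingAut : ℂ ≃+* ℂ) • s → u ≠ t → u ≠ (starRingAut : ℂ ≃+* ℂ) • t →
        σ • u = u)
    {x₀ : K i₀ →+* ℂ} (O : Set (K i₁ →+* ℂ)) (hO : ∀ y ∈ O, ∀ y' ∈ O, ∃ g : ℂ ≃+* ℂ, g • x₀ = x₀ ∧ g • y = y')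
    (hoff : ∀ y : K i₁ →+* ℂ, y ∉ O → (starRingAut : ℂ ≃+* ℂ) • y ∉ O →
      ∃ σ : ℂ ≃+* ℂ, σ • x₀ = (starRingAut : ℂ ≃+* ℂ) • x₀ ∧ σ • y = y)
    (hA : ∀ i, IsCMTypeRealisation (Φ i) (A i) (ι i) (θ i)) (hs : ∀ i, (A i).IsSimple)
    (hniso : ∀ i i', i ≠ i' → ¬ AbelianVariety.IsIsogenous (A i) (A i')) :
    (∀ (N : ℕ) (π : Fin N → I) (m : ℕ),
      hodgeClassSpan (⨁ fun j : Fin N => A (π j)).dim (⨁ fun j : Fin N => A (π j)).X m =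
        divisorClassesSpan (⨁ fun j : Fin N => A (π j)).X (⨁ fun j : Fin N => A (π j)).dim m) ↔
      IsNondegenerate (Φ i₁) ∧ ¬ ∃ a b : ℕ, a ≠ b ∧ ∀ g : ℂ ≃+* ℂ,
        (Finset.univ.filter fun y : K i₁ →+* ℂ => y ∈ O ∧ g • y ∈ (Φ i₁).1).card =
          if g • x₀ ∈ (Φ i₀).1 then a else b := by
  rw [← CMAlgebra.isNondegenerateFamily_iff_forall_prod_hodgeClassSpan_eq
    (CMAlgebra.isSeparatingFamily_of_isSimple_of_pairwise_not_isIsogenous hA hs hniso) hA]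
  exact isNondegenerateFamily_iff_of_doubleFlip_of_orbit hI h01 h6 hflip O hO hoff

end Varieties

end Summit.HodgeConjecture.CorCM

end
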